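import Mathlib

/-!
# Route `KPlusLogSqLaw`, crux `TropicalB` (stmt-ValiantsHypothesis-19771) — the SINGLE-CYCLE LAW for a forced entry:
# an optimum constrained at one row differs from the unique unconstrained optimum on ONE cycle through that row

HONEST FRAMING.  Helper file (cell `pub-symmetroid`, seat val-sym-trop-p5 g27, refuter-adjacent lane, 2026-08-29; `--supports
stmt-ValiantsHypothesis-19771 --as helper`).  PURE COMBINATORICS of weighted bijections between finite types (no design, no `IsDominant`, no
census constant in any type).  It is the structural fact behind §3.3′ («frozen-parent law: nested residual lives are PATH families») of the
seat's memo LEX-PRODUCT-g27.md (evidence #60 on 19771): placing a giant (forcing one entry, equivalently deleting one row and one column) moves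
the optimal assignment along a single exchange cycle through the forced row, so while a block is frozen every optimum of a one-deletion
sub-block is the frozen matching modified along ONE alternating path.  Companion of `…TropicalBCoverExchange` (#2).  Nothing here bounds
`TropicalB`; nothing on `WeakLifting`, DoorA26 / DoorA34, `MatrixDescartes` (stmt-ValiantsHypothesis-18050) or VP ≠ VNP.

THE LAW (`sameCycle_of_forced`).  Rows `R` (finite), columns `C`, integer weights `w`; `M : R ≃ C` the UNIQUE maximum-weight bijection;
`N : R ≃ C` of maximum weight among the bijections agreeing with `N` at the row `r` (the entry `(r, N r)` is FORCED).  Then every row at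
which `N` and `M` differ lies on the cycle of `r` of the exchange permutation `π = M⁻¹ ∘ N` (`π i = M.symm (N i)`): `N` and `M` differ on a
SINGLE cycle, the one through the forced row (and if `N r = M r` then `N = M`, `eq_of_forced_eq`).  Proof: for a row `i₀` off the cycle of
`r`, swap `M` and `N` along the cycle `Z` of `i₀` (`M ∘ π.cycleOf i₀` and `N ∘ (π.cycleOf i₀)⁻¹`, both bijections, the second still forced at
`r`); the two swapped weights add up to `w(M) + w(N)` (`sum_swap_cycle`), the first is `≤ w(M)` strictly unless the swap is trivial, the
second is `≤ w(N)` — so the swap is trivial and `N i₀ = M i₀`.  [folklore: exchange argument for assignment optima; packaging this seat]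
-/

set_option linter.dupNamespace false
set_option autoImplicit false

namespace Summit.ValiantsHypothesis.ValiantsHypothesis.Theorems.KPlusLogSqLaw

namespace ForcedCycle

open Finset Equiv

variable {R C : Type*} [Fintype R] [DecidableEq R]

/-- the cycle swap: on the cycle of `i₀` of `π = M⁻¹N`, `M ∘ π.cycleOf i₀` takes `N`'s values and `N ∘ (π.cycleOf i₀)⁻¹` takes `M`'s values;
elsewhere both are unchanged. [folklore] -/
theorem swap_values (M N : R ≃ C) (i₀ i : R) :
    (M ((Equiv.Perm.cycleOf (N.trans M.symm) i₀) i) = if Equiv.Perm.SameCycle (N.trans M.symm) i₀ i then N i else M i) ∧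
    (N ((Equiv.Perm.cycleOf (N.trans M.symm) i₀)⁻¹ i) = if Equiv.Perm.SameCycle (N.trans M.symm) i₀ i then M i else N i) := by
  set π : Equiv.Perm R := N.trans M.symm with hπ
  have hπapp : ∀ j, π j = M.symm (N j) := fun j => rfl
  constructor
  · rw [Equiv.Perm.cycleOf_apply]
    split_ifs with h
    · rw [hπapp]; simp
    · rfl
  · rw [Equiv.Perm.cycleOf_inv, Equiv.Perm.cycleOf_apply]
    by_cases h : π.SameCycle i₀ i
    · have h' : π⁻¹.SameCycle i₀ i := (Equiv.Perm.sameCycle_inv).mpr h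
      rw [if_pos h', if_pos h]
      -- `π⁻¹ i = j` with `M.symm (N j) = i`, i.e. `N j = M i`
      have : π (π⁻¹ i) = i := π.apply_symm_apply i
      rw [hπapp] at this
      have h2 : N (π⁻¹ i) = M i := by
        have := congrArg M this
        simpa using this
      exact h2
    · have h' : ¬ π⁻¹.SameCycle i₀ i := fun hh => h ((Equiv.Perm.sameCycle_inv).mp hh)
      rw [if_neg h', if_neg h]

/-- the two swapped weights add up to `w(M) + w(N)`. [folklore] -/
theorem sum_swap_cycle (w : R → C → ℤ) (M N : R ≃ C) (i₀ : R) :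
    ∑ i, w i (M ((Equiv.Perm.cycleOf (N.trans M.symm) i₀) i)) +
      ∑ i, w i (N ((Equiv.Perm.cycleOf (N.trans M.symm) i₀)⁻¹ i)) = ∑ i, w i (M i) + ∑ i, w i (N i) := by
  rw [← sum_add_distrib, ← sum_add_distrib]
  refine sum_congr rfl fun i _ => ?_
  rw [(swap_values M N i₀ i).1, (swap_values M N i₀ i).2]
  split_ifs <;> ring

/-- **SINGLE-CYCLE LAW for a forced entry.**  `M` the unique maximum-weight bijection, `N` of maximum weight among bijections forced to
agree with `N` at row `r`: every row where `N ≠ M` is on the cycle of `r` of `M⁻¹ ∘ N`. [folklore: exchange argument] -/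
theorem sameCycle_of_forced (w : R → C → ℤ) (M N : R ≃ C) (r : R)
    (hM : ∀ σ : R ≃ C, σ ≠ M → ∑ i, w i (σ i) < ∑ i, w i (M i))
    (hN : ∀ σ : R ≃ C, σ r = N r → ∑ i, w i (σ i) ≤ ∑ i, w i (N i)) :
    ∀ i, N i ≠ M i → Equiv.Perm.SameCycle (N.trans M.symm) r i := by
  intro i₀ hi₀
  by_contra hnot
  -- swap along the cycle of `i₀`
  set M' : R ≃ C := (Equiv.Perm.cycleOf (N.trans M.symm) i₀).trans M with hM'
  set N' : R ≃ C := (Equiv.Perm.cycleOf (N.trans M.symm) i₀).symm.trans N with hN'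
  have hM'app : ∀ i, M' i = M ((Equiv.Perm.cycleOf (N.trans M.symm) i₀) i) := fun i => rfl
  have hN'app : ∀ i, N' i = N ((Equiv.Perm.cycleOf (N.trans M.symm) i₀)⁻¹ i) := fun i => rfl
  -- `N'` is still forced at `r` (the cycle of `i₀` misses `r`)
  have hN'r : N' r = N r := by
    rw [hN'app, (swap_values M N i₀ r).2, if_neg]
    exact fun h => hnot h.symm
  have hsum := sum_swap_cycle w M N i₀
  have h1 : ∑ i, w i (N' i) ≤ ∑ i, w i (N i) := hN N' hN'r
  have e1 : ∑ i, w i (M' i) = ∑ i, w i (M ((Equiv.Perm.cycleOf (N.trans M.symm) i₀) i)) :=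
    sum_congr rfl fun i _ => rfl
  have e2 : ∑ i, w i (N' i) = ∑ i, w i (N ((Equiv.Perm.cycleOf (N.trans M.symm) i₀)⁻¹ i)) :=
    sum_congr rfl fun i _ => rfl
  -- hence `M'` has the weight of `M`, so `M' = M`
  have hM'eq : M' = M := by
    by_contra hne
    have h2 := hM M' hne
    rw [e1] at h2; rw [e2] at h1
    omega
  -- read off `N i₀ = M i₀`
  have h3 : M' i₀ = M i₀ := by rw [hM'eq]
  rw [hM'app, (swap_values M N i₀ i₀).1, if_pos (Equiv.Perm.SameCycle.refl _ i₀)] at h3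
  exact hi₀ h3

omit [DecidableEq R] in
/-- in particular, if the forced entry agrees with the unconstrained optimum the two optima coincide. [folklore] -/
theorem eq_of_forced_eq (w : R → C → ℤ) (M N : R ≃ C) (r : R)
    (hM : ∀ σ : R ≃ C, σ ≠ M → ∑ i, w i (σ i) < ∑ i, w i (M i))
    (hN : ∀ σ : R ≃ C, σ r = N r → ∑ i, w i (σ i) ≤ ∑ i, w i (N i)) (hr : N r = M r) : N = M := by
  by_contra hne
  have h1 := hM N hne
  have h2 := hN M hr.symm
  omega

/-- **PATH FORM.**  Under the same hypotheses with `N r ≠ M r`, the rows where `N` and `M` differ are exactly the support of ONE cycle of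
`M⁻¹ ∘ N`, the one through `r` — i.e. `N` is `M` modified along the single alternating path from the row `M⁻¹ (N r)` to the column `M r`
closed up through the forced entry `(r, N r)`.  Stated as: `N i ≠ M i ↔ SameCycle r i`. [folklore] -/
theorem ne_iff_sameCycle_of_forced (w : R → C → ℤ) (M N : R ≃ C) (r : R)
    (hM : ∀ σ : R ≃ C, σ ≠ M → ∑ i, w i (σ i) < ∑ i, w i (M i))
    (hN : ∀ σ : R ≃ C, σ r = N r → ∑ i, w i (σ i) ≤ ∑ i, w i (N i)) (hr : N r ≠ M r) (i : R) :
    N i ≠ M i ↔ Equiv.Perm.SameCycle (N.trans M.symm) r i := by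
  constructor
  · exact sameCycle_of_forced w M N r hM hN i
  · intro h hi
    -- a fixed point of `π` is alone in its cycle, but `r` is not fixed
    have hfix : (N.trans M.symm) i = i := by
      show M.symm (N i) = i
      rw [hi]; simp
    have key : (N.trans M.symm) r = r := (Equiv.Perm.SameCycle.apply_eq_self_iff h).mpr hfix
    apply hr
    have h2 : M.symm (N r) = r := key
    have h3 := congrArg M h2
    simpa using h3

end ForcedCycle

end Summit.ValiantsHypothesis.ValiantsHypothesis.Theorems.KPlusLogSqLaw
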